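import Literature.Analysis.FluidPDE.PineauVicolLerayBounds
import Literature.Analysis.FluidPDE.PineauVicolWeightedIdentity
import HarnessLib

/-!
# Route TypeICertificateLadder — crux `Target` (item stmt-NavierStokesRegularity-1217),
# line `killing-twisted-bernoulli-solitons`: the RSS profile system, its bounds, and the
# elementary endgame of the soliton enstrophy law

Helper file (theorems only) for stub B3 (`stub_solitonLaws`, file
`TypeICertificateLadderTargetSolitonLaws.lean`). Setting: a classical Navier–Stokes solution
`(u, p)` on `ℝ³ × [−1, 0)` which is the rotated self-similar (RSS) ansatz `u = pvAnsatz α U` of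
Pineau–Vicol (arXiv:2607.09619, (1.7)) with a time-independent profile `U`.

* `rss_profile_system` — **the profile system (1.8a) with a smooth pressure**:
  `α(JU − DU[Jy]) + ½U + ½DU[y] − ΔU + DU[U] + ∇P = 0`, `∇·U = 0`, `U, P ∈ C^∞` (`J = rotGen`).
  Route: extend `u` backwards to a classical solution on `(−∞, 0)`
  (`PineauVicol2026.exists_isClassicalNSSolutionOn_Iio_of_isRotatedDSS`), pass to the backward
  similarity (Leray) variables (`isClassicalNSSolutionOn_Iio_iff_isBackwardLeraySolutionOn`), in
  which the profile is `V(s, y) = R(αs) U(R(−αs) y)` (`lerayOrbit_pvAnsatz`), and evaluate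
  Leray's momentum equation at `s = 0`, where `V(0, ·) = U` and
  `∂ₛV(0, y) = α(JU(y) − DU(y)[Jy])` (`hasDerivAt_rotZ_conj_zero`, from
  `R_θ v = v + sin θ • Jv + (1 − cos θ) • J(Jv)`).
* `rss_profile_bounds` — with the Type I bound: `‖U‖ ≤ C₀` and `‖DU‖, ‖ΔU‖ ≤ K` (the backward
  extension is Type I on `(−∞, 0)`; `PineauVicol2026.exists_forall_iteratedFDeriv_le_of_typeI`
  at `t = −1`).
* `norm_gradient_pressure_le` — from (1.8a) and these bounds, `‖∇P(y)‖ = O(1 + |y|)`;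
  `abs_le_of_norm_fderiv_le_linear` (mean value), `integrable_of_norm_le_poly_mul_gauss`
  (polynomial × Gaussian domination).
* `integral_curl_sq_mul_le_of_identity` — the Cauchy–Schwarz endgame: for a positive weight of
  unit mass, `∫|curl U|²m = 2α∫(curl U)₂m` forces `∫|curl U|²m ≤ 4α²`.
-/

noncomputable section

namespace Summit.NavierStokesRegularity.NavierStokesRegularity.Theorems

open Set Function Filter MeasureTheory
open Literature.Analysis.FluidPDE Literature.Analysis.FluidPDE.PineauVicol2026
open scoped RealInnerProductSpace Laplacian ContDiff Topology

/-- The rotation about the axis through its generator: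
`R_θ v = v + sin θ • Jv + (1 − cos θ) • J(Jv)` (`J = rotGen`, `J(Jv) = −(v₀, v₁, 0)`). [folklore] -/
theorem rotZ_eq_add_sin_smul_rotGen (θ : ℝ) (v : EuclideanSpace ℝ (Fin 3)) :
    rotZ θ v = v + Real.sin θ • rotGen v + (1 - Real.cos θ) • rotGen (rotGen v) := by
  ext i
  fin_cases i <;> simp [rotZ, rotGen] <;> ring

/-- **The `s`-derivative of the rotating profile at `s = 0`.** For `U` differentiable,
`d/ds [R(αs) U(R(−αs) y)]|_{s=0} = α (J U(y) − DU(y)[J y])`. [folklore] -/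
theorem hasDerivAt_rotZ_conj_zero {U : EuclideanSpace ℝ (Fin 3) → EuclideanSpace ℝ (Fin 3)}
    (hU : Differentiable ℝ U) (α : ℝ) (y : EuclideanSpace ℝ (Fin 3)) :
    HasDerivAt (fun s : ℝ => rotZ (α * s) (U (rotZ (-(α * s)) y)))
      (α • (rotGen (U y) - fderiv ℝ U y (rotGen y))) 0 := by
  -- the inner curve `s ↦ R(−αs) y` and `g s = U (R(−αs) y)`
  have hlin' : HasDerivAt (fun s : ℝ => α * s) α 0 := by
    simpa using (hasDerivAt_id (0 : ℝ)).const_mul α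
  have hlin : HasDerivAt (fun s : ℝ => -(α * s)) (-α) 0 := hlin'.neg
  have hrot : HasDerivAt (fun s : ℝ => rotZ (-(α * s)) y) ((-α) • rotGen y) 0 := by
    have h0 : HasDerivAt (fun θ => rotZ θ y) (rotGen y) (-(α * 0)) := by
      rw [mul_zero, neg_zero]; exact hasDerivAt_rotZ_zero y
    exact h0.scomp (0 : ℝ) hlin
  have hg : HasDerivAt (fun s : ℝ => U (rotZ (-(α * s)) y))
      (fderiv ℝ U y ((-α) • rotGen y)) 0 := by
    have hUy : HasFDerivAt U (fderiv ℝ U y) (rotZ (-(α * 0)) y) := by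
      rw [mul_zero, neg_zero, rotZ_zero]; exact (hU y).hasFDerivAt
    exact hUy.comp_hasDerivAt (0 : ℝ) hrot
  -- the trigonometric coefficients
  have hsin : HasDerivAt (fun s : ℝ => Real.sin (α * s)) α 0 :=
    hlin'.sin.congr_deriv (by simp)
  have hcos : HasDerivAt (fun s : ℝ => 1 - Real.cos (α * s)) 0 0 :=
    (hlin'.cos.const_sub 1).congr_deriv (by simp)
  -- `J ∘ g` and `J ∘ J ∘ g`
  have hJg : HasDerivAt (fun s : ℝ => rotGen (U (rotZ (-(α * s)) y)))
      (rotGen (fderiv ℝ U y ((-α) • rotGen y))) 0 := by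
    have h := rotGenL.hasFDerivAt.comp_hasDerivAt (0 : ℝ) hg
    simpa only [Function.comp_def, rotGenL_apply] using h
  have hJJg : HasDerivAt (fun s : ℝ => rotGen (rotGen (U (rotZ (-(α * s)) y))))
      (rotGen (rotGen (fderiv ℝ U y ((-α) • rotGen y)))) 0 := by
    have h := rotGenL.hasFDerivAt.comp_hasDerivAt (0 : ℝ) hJg
    simpa only [Function.comp_def, rotGenL_apply] using h
  have hsum := (hg.add (hsin.smul hJg)).add (hcos.smul hJJg)
  have e : (fun s : ℝ => rotZ (α * s) (U (rotZ (-(α * s)) y))) = fun s : ℝ =>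
      U (rotZ (-(α * s)) y) + Real.sin (α * s) • rotGen (U (rotZ (-(α * s)) y)) +
        (1 - Real.cos (α * s)) • rotGen (rotGen (U (rotZ (-(α * s)) y))) :=
    funext fun s => rotZ_eq_add_sin_smul_rotGen _ _
  rw [e]
  refine hsum.congr_deriv ?_
  simp only [mul_zero, neg_zero, rotZ_zero, Real.sin_zero, Real.cos_zero, sub_self, zero_smul,
    add_zero, zero_add, map_smul, map_neg, neg_smul, smul_sub]
  abel

/-- **The RSS profile system (1.8a) with a smooth pressure.** Let `(u, p)` be a classical
Navier–Stokes solution (`ν = 1`, `f = 0`) on `[−1, 0)` which agrees there with the RSS ansatz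
`pvAnsatz α U` (1.7) for a time-independent profile `U`. Then `U ∈ C^∞`, `∇·U = 0`, and there is
a smooth `P` with `α(JU − DU[Jy]) + ½U + ½DU[y] − ΔU + DU[U] + ∇P = 0` on `ℝ³`
(`J = rotGen`): the backward extension to `(−∞, 0)` read in Leray variables at `s = 0`.
[cite: PineauVicol2026, (1.7)–(1.8) (arXiv:2607.09619 p. 3)] -/
theorem rss_profile_system :
    ∀ (α : ℝ) (u : ℝ → EuclideanSpace ℝ (Fin 3) → EuclideanSpace ℝ (Fin 3)) (p : ℝ → EuclideanSpace ℝ (Fin 3) → ℝ) (U : EuclideanSpace ℝ (Fin 3) → EuclideanSpace ℝ (Fin 3)), Literature.Analysis.FluidPDE.IsClassicalNSSolutionOn (Set.Ico (-1) 0) 1 0 u p → (∀ t ∈ Set.Ico (-1 : ℝ) 0, ∀ x : EuclideanSpace ℝ (Fin 3), u t x = Literature.Analysis.FluidPDE.pvAnsatz α (fun y _ => U y) t x) → ∃ P : EuclideanSpace ℝ (Fin 3) → ℝ, ContDiff ℝ (⊤ : ℕ∞) U ∧ ContDiff ℝ (⊤ : ℕ∞) P ∧ Literature.Analysis.FluidPDE.VectorCalculus.IsDivFree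 U ∧ ∀ y : EuclideanSpace ℝ (Fin 3), α • (Literature.Analysis.FluidPDE.rotGen (U y) - fderiv ℝ U y (Literature.Analysis.FluidPDE.rotGen y)) + (1 / 2 : ℝ) • U y + (1 / 2 : ℝ) • fderiv ℝ U y y - Laplacian.laplacian U y + fderiv ℝ U y (U y) + gradient P y = 0 := by
  intro α u p U hsol hans
  obtain ⟨Pt, hPt⟩ := exists_isClassicalNSSolutionOn_Iio_of_isRotatedDSS hsol one_lt_two
    (isRotatedDSS_pvAnsatz (α := α) (U := fun y _ => U y) two_pos fun _ _ => rfl) hans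
  have hL := isClassicalNSSolutionOn_Iio_iff_isBackwardLeraySolutionOn.1 hPt
  have hV : ∀ s y, lerayOrbit (pvAnsatz α (fun y _ => U y)) s y =
      rotZ (α * s) (U (rotZ (-(α * s)) y)) := fun s y =>
    lerayOrbit_pvAnsatz α (fun y _ => U y) s y
  have hV0 : lerayOrbit (pvAnsatz α (fun y _ => U y)) 0 = U := by
    funext y; rw [hV, mul_zero, neg_zero, rotZ_zero, rotZ_zero]
  have hwU : pvAnsatz α (fun y _ => U y) (-1) = U := funext fun x => pvAnsatz_neg_one α _ x
  have hUs : ContDiff ℝ ∞ U := by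
    have h := hPt.contDiff_velocity (show (-1 : ℝ) ∈ Iio 0 by norm_num)
    rwa [hwU] at h
  refine ⟨lerayOrbitPressure Pt 0, hUs, hL.contDiff_pressure (mem_univ 0), ?_, fun y => ?_⟩
  · have h := hL.divFree 0 (mem_univ 0)
    rwa [hV0] at h
  · have hm := hL.momentum_leray (mem_univ 0) y
    have htd : timeDerivWithin univ (lerayOrbit (pvAnsatz α (fun y _ => U y))) 0 y =
        α • (rotGen (U y) - fderiv ℝ U y (rotGen y)) := by
      rw [timeDerivWithin_apply, derivWithin_univ]
      have e : (fun s => lerayOrbit (pvAnsatz α (fun y _ => U y)) s y) =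
          fun s => rotZ (α * s) (U (rotZ (-(α * s)) y)) :=
        funext fun s => hV s y
      rw [e]
      exact (hasDerivAt_rotZ_conj_zero (hUs.differentiable (by simp)) α y).deriv
    rw [htd, hV0, convect_apply, one_smul] at hm
    rw [← hm]
    abel

-- adapted from Literature/Analysis/FluidPDE/PineauVicolLerayPressure.lean
-- (`PineauVicol2026.norm_laplacian_le_three_mul`, not importable here without a heavy import)
/-- `‖Δf(x)‖ ≤ 3‖D²f(x)‖` on `ℝ³` (the Laplacian as a trace over an orthonormal frame).
[folklore] -/
theorem norm_laplacian_le_three_mul_iteratedFDeriv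
    (f : EuclideanSpace ℝ (Fin 3) → EuclideanSpace ℝ (Fin 3)) (x : EuclideanSpace ℝ (Fin 3)) :
    ‖(Δ f) x‖ ≤ 3 * ‖iteratedFDeriv ℝ 2 f x‖ := by
  set b := stdOrthonormalBasis ℝ (EuclideanSpace ℝ (Fin 3)) with hb
  rw [InnerProductSpace.laplacian_eq_iteratedFDeriv_orthonormalBasis f b]
  calc ‖∑ i, iteratedFDeriv ℝ 2 f x ![b i, b i]‖ ≤ ∑ i, ‖iteratedFDeriv ℝ 2 f x ![b i, b i]‖ :=
        norm_sum_le _ _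
    _ ≤ ∑ _i : Fin (Module.finrank ℝ (EuclideanSpace ℝ (Fin 3))), ‖iteratedFDeriv ℝ 2 f x‖ :=
        Finset.sum_le_sum fun i _ => by
        refine (ContinuousMultilinearMap.le_opNorm _ _).trans ?_
        rw [Fin.prod_univ_two]
        simp only [Matrix.cons_val_zero, Matrix.cons_val_one, b.orthonormal.1 i, mul_one]
        rfl
    _ = 3 * ‖iteratedFDeriv ℝ 2 f x‖ := by
        rw [Finset.sum_const, Finset.card_univ, Fintype.card_fin, finrank_euclideanSpace_fin]; simp

/-- **Bounds for the RSS profile from the Type I bound** (Remark 1.2 and Lemma 7.1 of the source at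
`t = −1`): under the hypotheses of `rss_profile_system` and the Type I bound
`‖u(t,x)‖ ≤ C₀/(‖x‖ + √(−t))` on `[−1, 0)`, the profile obeys `‖U‖ ≤ C₀` and, for some `K ≥ 0`,
`‖DU(y)‖ ≤ K`, `‖ΔU(y)‖ ≤ K` for all `y` (the backward extension is Type I on `(−∞, 0)` with the
same constant, `norm_pvAnsatz_le_of_profile`, and `exists_forall_iteratedFDeriv_le_of_typeI`
applies at `t = −1`, where `u(−1, ·) = U`).
[cite: PineauVicol2026, Remark 1.2 and Lemma 7.1 (arXiv:2607.09619 pp. 3, 23)] -/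
theorem rss_profile_bounds {C₀ α : ℝ} {u : ℝ → EuclideanSpace ℝ (Fin 3) → EuclideanSpace ℝ (Fin 3)}
    {p : ℝ → EuclideanSpace ℝ (Fin 3) → ℝ} {U : EuclideanSpace ℝ (Fin 3) → EuclideanSpace ℝ (Fin 3)}
    (hsol : IsClassicalNSSolutionOn (Ico (-1) 0) 1 0 u p)
    (hI : ∀ t ∈ Ico (-1 : ℝ) 0, ∀ x, ‖u t x‖ ≤ C₀ / (‖x‖ + Real.sqrt (-t)))
    (hans : ∀ t ∈ Ico (-1 : ℝ) 0, ∀ x, u t x = pvAnsatz α (fun y _ => U y) t x) :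
    0 ≤ C₀ ∧ (∀ y, ‖U y‖ ≤ C₀) ∧
      ∃ K : ℝ, 0 ≤ K ∧ ∀ y, ‖fderiv ℝ U y‖ ≤ K ∧ ‖(Δ U) y‖ ≤ K := by
  have hUb : ∀ y, ‖U y‖ ≤ C₀ / (‖y‖ + 1) := profile_bound_of_typeI hI hans
  have hC₀ : 0 ≤ C₀ := by
    have h := (norm_nonneg _).trans (hUb 0)
    rwa [norm_zero, zero_add, div_one] at h
  refine ⟨hC₀, fun y => (hUb y).trans (div_le_self hC₀ (by linarith [norm_nonneg y])), ?_⟩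
  obtain ⟨Pt, hPt⟩ := exists_isClassicalNSSolutionOn_Iio_of_isRotatedDSS hsol one_lt_two
    (isRotatedDSS_pvAnsatz (α := α) (U := fun y _ => U y) two_pos fun _ _ => rfl) hans
  have hIw : ∀ t ∈ Iio (0 : ℝ), ∀ x,
      ‖pvAnsatz α (fun y _ => U y) t x‖ ≤ C₀ / (‖x‖ + Real.sqrt (-t)) :=
    fun t ht x => norm_pvAnsatz_le_of_profile hUb ht x
  obtain ⟨K₁, hK₁0, hK₁⟩ := exists_forall_iteratedFDeriv_le_of_typeI 1 C₀
  obtain ⟨K₂, hK₂0, hK₂⟩ := exists_forall_iteratedFDeriv_le_of_typeI 2 C₀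
  have hwU : pvAnsatz α (fun y _ => U y) (-1) = U := funext fun x => pvAnsatz_neg_one α _ x
  have hm1 : (-1 : ℝ) ∈ Iio 0 := by norm_num
  -- the factor `((max ‖x‖ √1)⁻¹)^(n+1) ≤ 1`
  have hfac : ∀ (x : EuclideanSpace ℝ (Fin 3)) (n : ℕ),
      ((max ‖x‖ (Real.sqrt (-(-1 : ℝ))))⁻¹) ^ n ≤ 1 := fun x n => by
    refine pow_le_one₀ (inv_nonneg.2 (le_max_of_le_right (Real.sqrt_nonneg _))) ?_
    refine inv_le_one_of_one_le₀ ?_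
    rw [neg_neg, Real.sqrt_one]; exact le_max_right _ _
  refine ⟨max K₁ (3 * K₂), le_max_of_le_left hK₁0, fun y => ⟨?_, ?_⟩⟩
  · have h := hK₁ _ Pt hPt hIw (-1) hm1 y
    rw [hwU] at h
    rw [← norm_iteratedFDeriv_zero (𝕜 := ℝ) (f := fderiv ℝ U), norm_iteratedFDeriv_fderiv]
    calc ‖iteratedFDeriv ℝ (0 + 1) U y‖
        ≤ K₁ * ((max ‖y‖ (Real.sqrt (-(-1 : ℝ))))⁻¹) ^ (1 + 1) := h
      _ ≤ K₁ * 1 := mul_le_mul_of_nonneg_left (hfac y _) hK₁0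
      _ ≤ max K₁ (3 * K₂) := by rw [mul_one]; exact le_max_left _ _
  · have h := hK₂ _ Pt hPt hIw (-1) hm1 y
    rw [hwU] at h
    calc ‖(Δ U) y‖ ≤ 3 * ‖iteratedFDeriv ℝ 2 U y‖ :=
          norm_laplacian_le_three_mul_iteratedFDeriv U y
      _ ≤ 3 * (K₂ * 1) := by
          gcongr
          exact h.trans (mul_le_mul_of_nonneg_left (hfac y _) hK₂0)
      _ ≤ max K₁ (3 * K₂) := by rw [mul_one]; exact le_max_right _ _

/-- **The pressure gradient of the RSS profile system grows at most linearly**: if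
`α(JU − DU[Jy]) + ½U + ½DU[y] − ΔU + DU[U] + ∇P = 0` with `‖U‖ ≤ C₀`, `‖DU‖ ≤ K`, `‖ΔU‖ ≤ K`,
then `‖∇P(y)‖ ≤ (|α|(C₀ + K) + C₀ + 2K + KC₀)(1 + ‖y‖)`. [folklore] -/
theorem norm_gradient_pressure_le {α C₀ K : ℝ}
    {U : EuclideanSpace ℝ (Fin 3) → EuclideanSpace ℝ (Fin 3)} {P : EuclideanSpace ℝ (Fin 3) → ℝ}
    (hC₀ : 0 ≤ C₀) (hK : 0 ≤ K) (hUb : ∀ y, ‖U y‖ ≤ C₀) (hDU : ∀ y, ‖fderiv ℝ U y‖ ≤ K)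
    (hΔU : ∀ y, ‖(Δ U) y‖ ≤ K)
    (heq : ∀ y, α • (rotGen (U y) - fderiv ℝ U y (rotGen y)) + (1 / 2 : ℝ) • U y +
      (1 / 2 : ℝ) • fderiv ℝ U y y - (Δ U) y + fderiv ℝ U y (U y) + gradient P y = 0)
    (y : EuclideanSpace ℝ (Fin 3)) :
    ‖gradient P y‖ ≤ (|α| * (C₀ + K) + C₀ + 2 * K + K * C₀) * (1 + ‖y‖) := by
  have hr := norm_nonneg y
  have e : gradient P y = -(α • (rotGen (U y) - fderiv ℝ U y (rotGen y)) + (1 / 2 : ℝ) • U y +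
      (1 / 2 : ℝ) • fderiv ℝ U y y - (Δ U) y + fderiv ℝ U y (U y)) :=
    eq_neg_of_add_eq_zero_right (heq y)
  have h1 : ‖α • (rotGen (U y) - fderiv ℝ U y (rotGen y))‖ ≤ |α| * (C₀ + K * ‖y‖) := by
    rw [norm_smul, Real.norm_eq_abs]
    refine mul_le_mul_of_nonneg_left ((norm_sub_le _ _).trans (add_le_add ?_ ?_)) (abs_nonneg _)
    · exact (norm_rotGen_le _).trans (hUb y)
    · exact (ContinuousLinearMap.le_opNorm _ _).trans
        (mul_le_mul (hDU y) (norm_rotGen_le y) (norm_nonneg _) hK)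
  have h2 : ‖(1 / 2 : ℝ) • U y‖ ≤ C₀ := by
    rw [norm_smul, Real.norm_of_nonneg (by norm_num : (0 : ℝ) ≤ 1 / 2)]
    linarith [hUb y, norm_nonneg (U y)]
  have h3 : ‖(1 / 2 : ℝ) • fderiv ℝ U y y‖ ≤ K * ‖y‖ := by
    rw [norm_smul, Real.norm_of_nonneg (by norm_num : (0 : ℝ) ≤ 1 / 2)]
    have h := (ContinuousLinearMap.le_opNorm (fderiv ℝ U y) y).trans
      (mul_le_mul_of_nonneg_right (hDU y) hr)
    linarith [norm_nonneg (fderiv ℝ U y y)]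
  have h5 : ‖fderiv ℝ U y (U y)‖ ≤ K * C₀ :=
    (ContinuousLinearMap.le_opNorm _ _).trans (mul_le_mul (hDU y) (hUb y) (norm_nonneg _) hK)
  have s1 : ‖α • (rotGen (U y) - fderiv ℝ U y (rotGen y)) + (1 / 2 : ℝ) • U y +
        (1 / 2 : ℝ) • fderiv ℝ U y y - (Δ U) y + fderiv ℝ U y (U y)‖
      ≤ ‖α • (rotGen (U y) - fderiv ℝ U y (rotGen y))‖ + ‖(1 / 2 : ℝ) • U y‖ +
        ‖(1 / 2 : ℝ) • fderiv ℝ U y y‖ + ‖(Δ U) y‖ + ‖fderiv ℝ U y (U y)‖ := by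
    refine (norm_add_le _ _).trans (add_le_add ?_ le_rfl)
    refine (norm_sub_le _ _).trans (add_le_add ?_ le_rfl)
    exact (norm_add_le _ _).trans (add_le_add (norm_add_le _ _) le_rfl)
  have s3 : |α| * (C₀ + K * ‖y‖) + C₀ + K * ‖y‖ + K + K * C₀ ≤
      (|α| * (C₀ + K) + C₀ + 2 * K + K * C₀) * (1 + ‖y‖) := by
    rw [← sub_nonneg]
    have ha := abs_nonneg α
    have ex : (|α| * (C₀ + K) + C₀ + 2 * K + K * C₀) * (1 + ‖y‖) -
        (|α| * (C₀ + K * ‖y‖) + C₀ + K * ‖y‖ + K + K * C₀) =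
        |α| * C₀ * ‖y‖ + |α| * K + C₀ * ‖y‖ + K + K * ‖y‖ + K * C₀ * ‖y‖ := by ring
    rw [ex]
    positivity
  have e' := norm_neg (α • (rotGen (U y) - fderiv ℝ U y (rotGen y)) + (1 / 2 : ℝ) • U y +
      (1 / 2 : ℝ) • fderiv ℝ U y y - (Δ U) y + fderiv ℝ U y (U y))
  rw [e, e']
  linarith [hΔU y]

/-- **Linear gradient growth gives quadratic growth**: if `f : ℝ³ → ℝ` is differentiable with
`‖Df(z)‖ ≤ A(1 + ‖z‖)`, then `|f(y)| ≤ (|f 0| + A)(1 + ‖y‖)²` (mean value inequality on the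
segment `[0, y]`). [folklore] -/
theorem abs_le_of_norm_fderiv_le_linear {f : EuclideanSpace ℝ (Fin 3) → ℝ} (hf : Differentiable ℝ f)
    {A : ℝ}
    (hA : 0 ≤ A) (h : ∀ z, ‖fderiv ℝ f z‖ ≤ A * (1 + ‖z‖)) (y : EuclideanSpace ℝ (Fin 3)) :
    |f y| ≤ (|f 0| + A) * (1 + ‖y‖) ^ 2 := by
  have hr := norm_nonneg y
  have hmv : ‖f y - f 0‖ ≤ A * (1 + ‖y‖) * ‖y - 0‖ :=
    (convex_closedBall (0 : EuclideanSpace ℝ (Fin 3)) ‖y‖).norm_image_sub_le_of_norm_fderiv_le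
      (𝕜 := ℝ)
      (fun z _ => hf z) (fun z hz => (h z).trans (by
        rw [Metric.mem_closedBall, dist_zero_right] at hz
        exact mul_le_mul_of_nonneg_left (by linarith) hA))
      (Metric.mem_closedBall_self hr) (by rw [Metric.mem_closedBall, dist_zero_right])
  rw [sub_zero, Real.norm_eq_abs] at hmv
  have h1 : |f y| ≤ |f 0| + A * (1 + ‖y‖) * ‖y‖ := by
    have := abs_sub_abs_le_abs_sub (f y) (f 0)
    linarith
  have h2 : (1 : ℝ) ≤ (1 + ‖y‖) ^ 2 := by nlinarith
  nlinarith [abs_nonneg (f 0), mul_nonneg hA hr]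

/-- **Polynomial × Gaussian domination gives integrability** on `ℝ³`: a continuous `f` with
`‖f(y)‖ ≤ A (1 + ‖y‖)ᴺ e^{−c‖y‖²}`, `c > 0`, is integrable
(`PineauVicol2026.integrable_one_add_norm_pow_mul_exp_neg_mul_sq`). [folklore] -/
theorem integrable_of_norm_le_poly_mul_gauss {F : Type*} [NormedAddCommGroup F]
    {f : EuclideanSpace ℝ (Fin 3) → F}
    (hf : Continuous f) (A : ℝ) (N : ℕ) {c : ℝ} (hc : 0 < c)
    (h : ∀ y, ‖f y‖ ≤ A * ((1 + ‖y‖) ^ N * Real.exp (-c * ‖y‖ ^ 2))) : Integrable f :=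
  ((integrable_one_add_norm_pow_mul_exp_neg_mul_sq hc N).const_mul A).mono'
    hf.aestronglyMeasurable (Eventually.of_forall h)

/-- **Cauchy–Schwarz endgame of the soliton enstrophy law.** For a positive continuous
weight `m` of unit mass and a field `U` with continuous curl, if `|curl U|² m` and
`(curl U)₂ m` are integrable and `∫ |curl U|² m = 2α ∫ (curl U)₂ m`, then
`∫ |curl U|² m ≤ 4α²`: `(∫ (curl U)₂ m)² ≤ (∫ (curl U)₂² m)(∫ m) ≤ ∫ |curl U|² m` (expand
`0 ≤ ∫ ((curl U)₂ − Y)² m` with `Y = ∫ (curl U)₂ m`), so `X = 2αY` gives `X² ≤ 4α²X`. [folklore] -/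
theorem integral_curl_sq_mul_le_of_identity {α : ℝ}
    {U : EuclideanSpace ℝ (Fin 3) → EuclideanSpace ℝ (Fin 3)} {m : EuclideanSpace ℝ (Fin 3) → ℝ}
    (hUc : Continuous (curl U)) (hmc : Continuous m) (hm0 : ∀ y, 0 < m y)
    (hm1 : ∫ y, m y = 1) (iΩ : Integrable (fun y => ‖curl U y‖ ^ 2 * m y))
    (i3 : Integrable (fun y => (curl U y) 2 * m y))
    (hid : ∫ y, ‖curl U y‖ ^ 2 * m y = 2 * α * ∫ y, (curl U y) 2 * m y) :
    ∫ y, ‖curl U y‖ ^ 2 * m y ≤ 4 * α ^ 2 := by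
  obtain ⟨X, hX⟩ : ∃ X : ℝ, X = ∫ y, ‖curl U y‖ ^ 2 * m y := ⟨_, rfl⟩
  obtain ⟨Y, hY⟩ : ∃ Y : ℝ, Y = ∫ y, (curl U y) 2 * m y := ⟨_, rfl⟩
  rw [← hX, ← hY] at hid
  rw [← hX]
  have hmI : Integrable m := Integrable.of_integral_ne_zero (by rw [hm1]; exact one_ne_zero)
  have h3c : Continuous (fun y => (curl U y) 2) :=
    (contDiff_euclideanCoord (n := 0) (2 : Fin 3)).continuous.comp hUc
  have hle : ∀ y, ((curl U y) 2) ^ 2 * m y ≤ ‖curl U y‖ ^ 2 * m y := fun y => by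
    refine mul_le_mul_of_nonneg_right ?_ (hm0 y).le
    have h := PiLp.norm_apply_le (curl U y) 2
    rw [Real.norm_eq_abs] at h
    calc ((curl U y) 2) ^ 2 = |(curl U y) 2| ^ 2 := (sq_abs _).symm
      _ ≤ ‖curl U y‖ ^ 2 := pow_le_pow_left₀ (abs_nonneg _) h 2
  have iZ : Integrable (fun y => ((curl U y) 2) ^ 2 * m y) :=
    iΩ.mono' ((h3c.pow 2).mul hmc).aestronglyMeasurable (Eventually.of_forall fun y => by
      rw [Real.norm_eq_abs, abs_of_nonneg (mul_nonneg (sq_nonneg _) (hm0 y).le)]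
      exact hle y)
  have hZX : ∫ y, ((curl U y) 2) ^ 2 * m y ≤ X := by
    rw [hX]; exact integral_mono iZ iΩ hle
  -- `0 ≤ ∫ ((curl U)₂ − Y)² m = ∫ (curl U)₂² m − Y²`
  have i3c : Integrable (fun y => 2 * Y * ((curl U y) 2 * m y)) := i3.const_mul (2 * Y)
  have imc : Integrable (fun y => Y ^ 2 * m y) := hmI.const_mul (Y ^ 2)
  have hexp : ∫ y, ((curl U y) 2 - Y) ^ 2 * m y = (∫ y, ((curl U y) 2) ^ 2 * m y) - Y ^ 2 := by
    have e : (fun y => ((curl U y) 2 - Y) ^ 2 * m y) =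
        fun y => ((curl U y) 2) ^ 2 * m y - 2 * Y * ((curl U y) 2 * m y) + Y ^ 2 * m y := by
      funext y; ring
    have iZs : Integrable (fun y => ((curl U y) 2) ^ 2 * m y - 2 * Y * ((curl U y) 2 * m y)) :=
      iZ.sub i3c
    rw [e, integral_add iZs imc, integral_sub iZ i3c, integral_const_mul,
      integral_const_mul, hm1, ← hY]
    ring
  have hnn : 0 ≤ ∫ y, ((curl U y) 2 - Y) ^ 2 * m y :=
    integral_nonneg fun y => mul_nonneg (sq_nonneg _) (hm0 y).le
  have hY2 : Y ^ 2 ≤ X := by linarith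
  have hXX : X * X ≤ 4 * α ^ 2 * X := by
    have e : X * X = 4 * α ^ 2 * Y ^ 2 := by rw [hid]; ring
    nlinarith [sq_nonneg α]
  by_cases hX0 : X ≤ 0
  · exact hX0.trans (by positivity)
  · exact le_of_mul_le_mul_right hXX (not_le.1 hX0)

end Summit.NavierStokesRegularity.NavierStokesRegularity.Theorems

end
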